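import Literature.MathematicalPhysics.QuantumFieldTheory.Balaban1983to89.B9SectBGpStepAtLetters
import Literature.MathematicalPhysics.QuantumFieldTheory.Balaban1983to89.B9Ineq346L2SecondDiffUniform
import Literature.MathematicalPhysics.QuantumFieldTheory.Balaban1983to89.B9Ineq346L2RightDiffUniform

/-!
# `Balaban1983to89.B9SectBGpStepAtLettersL2TwoDiff` — [B9] Sect. B, the two-difference L² members (3.46)₄ ∕ (3.46)₆ of G′(U′U)
# PINNED AT THE LETTERS of the tree's Sect. B programme: `L2TwoDiffFrame` + ★ `stepL2nPos_three_of_l2TwoDiffFrame`,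
# ★ `stepL2nPos_five_of_l2TwoDiffFrame` (sibling of `B9SectBGpStepAtLetters`, split off for size)

T. Bałaban, *Propagators for lattice gauge theories in a background field*, Commun. Math. Phys. **99** (1985) 389–434
[`Balaban1985BackgroundPropagators`, "B9"]; [4] = T. Bałaban, *Propagators and renormalization transformations for lattice
gauge theories. II*, Commun. Math. Phys. **96** (1984) 223–250 [`Balaban1984PropagatorsII`].

statement-level skeleton of published theorems with citation tags; proofs where landed; nothing here is a claim about the
Yang–Mills mass gap

THE PRINTED LOCUS (verbatim).  (3.46) p. 398 (the six L² members of Theorem 3.1, the last three with two differences: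
‖h∇_U∇_UG′λ‖, ‖h∇_UG′∇*_Uλ‖, ‖hG′∇*_U∇*_Uλ‖ ≦ B₀|h|e^{−δ₀d(y,y′)}‖λ‖); p. 402 after (3.64): *"we can prove all the statements
(3.42)–(3.47) for the operator G′(U′U), of course with different constants"*; p. 403 l. 7–9: *"the remainders … satisfy Theorem
3.1 with the additional small factor O(1)α₁"*.

THE POINT.  `B9SectBGpStepAtLetters` (v1.2) framed the one-difference L² members (3.46)₁,₂,₃,₅ of G′(U′U) (`L2Frame`,
`stepL2nPos_of_l2Frame`, members n = 0, 1, 2, 4 of `B9.pref6`) on the letters of the tree's Sect. B programme, WITH THE KERNEL-FORM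
INPUT DISPLAYED as the named law `ker31` (seat n06-c's LOCATED-3, dag-lead WORDS-114 (b): the L² transfers of the tree take
Theorem 3.1 for G′(U) in the printed KERNEL form, [4] (2.64)–(2.66), which the cell's sup readings do not carry — N06 content,
not a reading).  THIS FILE does the same for the two remaining members: (3.46)₄ (two LEFT differences, member n = 3) from r06's
`B9Ineq346L2SecondDiffUniform.thm34_Gp_l2_second_uniform` and (3.46)₆ (two RIGHT differences, member n = 5) from
`B9Ineq346L2RightDiffUniform.thm34_Gp_l2_right_uniform`.  Both take, besides the kernel letters, the corresponding member AT U as an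
L² block input `h346` — which IS a reading of the leaf's hypothesis `L2Block (Gp i) B₀ δ₀ U` (fields `read46_4` ∕ `read46_6`) —
and their conclusions (viii′) ∕ (viii″) for the family's own G′(U′U) (identified with r06's extension by `gop_eq` ∘ `mul_law`, as in
every frame) are written back as the members n = 3, 5 at U′U (`writeL2_4` ∕ `writeL2_6`).  After this file the G′-side of row 13 of
node N06 is framed completely except the analytic-extension step: 13-E, 13-Glob, 13-H1, 13-E4, 13-H2, 13-L2ₙ (n = 0…5), plus 13-Ker —
twelve of the twenty-four steps, the six L² ones modulo the displayed law `ker31`.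

HONEST SCOPE.  Hypothesis structure + quantifier bookkeeping + uniqueness of two-sided inverses; r06's theorems USED BY NAME; the
frame's inhabitant (the operator layer of record) is not in the tree; the law `ker31` is N06 content carried openly; count-neutral;
NOT a node discharge; nothing continuum, nothing about the mass gap.  Cell `pub-ymgap` (HUMAN RULING D-0062), Track A node N06
[B9], N06-ASSIGNMENT row 13, seat `pub-ymgap-dag-n06-c` (g2), 2026-08-26.
-/

noncomputable section

namespace Literature.MathematicalPhysics.QuantumFieldTheory.Balaban1983to89.B9SectBGpStepAtLettersL2TwoDiff

open Literature.MathematicalPhysics.QuantumFieldTheory.Balaban1983to89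
open Literature.MathematicalPhysics.QuantumFieldTheory.Balaban1983to89.B6RandomWalk (HasMajorant hasMajorant_mono Triangle254 Ineq261)
open Literature.MathematicalPhysics.QuantumFieldTheory.Balaban1983to89.B9Thm34Ext (toB6)
open Literature.MathematicalPhysics.QuantumFieldTheory.Balaban1983to89.B9Ineq347 (ScaleTransfer)
open Literature.MathematicalPhysics.QuantumFieldTheory.Balaban1983to89.B9Eq39Adjoint (covD covDstar)
open Literature.MathematicalPhysics.QuantumFieldTheory.Balaban1983to89.B9Eq352DivForm (tauB)
open Literature.MathematicalPhysics.QuantumFieldTheory.Balaban1983to89.B9Eq352DivFormLetters (conj)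
open Literature.MathematicalPhysics.QuantumFieldTheory.Balaban1983to89.B9Eq352GradLetters (diffLetter)
open Literature.MathematicalPhysics.QuantumFieldTheory.Balaban1983to89.B9Eq360Vprime (gPrimeExtEnd)
open Literature.MathematicalPhysics.QuantumFieldTheory.Balaban1983to89.B9Eq360VprimeLetters (vPrimeConc)
open Literature.MathematicalPhysics.QuantumFieldTheory.Balaban1983to89.B9FromB6 (EBlock)
open Literature.MathematicalPhysics.QuantumFieldTheory.Balaban1983to89.B9SectBStepWhole (StepPos StepL2nPos)
open Literature.MathematicalPhysics.QuantumFieldTheory.Balaban1983to89.B9SectBGpStepAtLetters (GpFrame L2Frame)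

universe u

variable {I : Type} (d : ℕ) (c35 : ℝ) (geo : I → B9.Geometry) (bg : I → B9.Backgrounds)
  (Gp : ∀ i, B9.KernelFamily (geo i) (bg i))
  {𝔸 : Type u} [NormedRing 𝔸] [NormedAlgebra ℂ 𝔸] [CompleteSpace 𝔸] {ι : Type} [Fintype ι] [DecidableEq ι]
  (b : Module.Basis ι ℝ 𝔸) (κ : Type) [Fintype κ]
  (S : I → Type) [∀ i, Fintype (S i)] [∀ i, DecidableEq (S i)]
  [∀ i, Fintype (geo i).Site] [∀ i, DecidableEq (geo i).Site] [∀ i, Nonempty (geo i).Site]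

/-- Profile bookkeeping: `c·p·e^{−δd} ≦ c′·p·e^{−δ′d}` for `c ≦ c′`, `0 ≦ c′`, `δ′ ≦ δ`, `p, d ≧ 0`. [folklore] -/
private theorem prof_le {c c' δ δ' d p : ℝ} (hp : 0 ≤ p) (hc : c ≤ c') (hc' : 0 ≤ c') (hδ : δ' ≤ δ) (hd : 0 ≤ d) :
    c * p * Real.exp (-(δ * d)) ≤ c' * p * Real.exp (-(δ' * d)) :=
  mul_le_mul (mul_le_mul_of_nonneg_right hc hp) (Real.exp_le_exp.2 (by nlinarith)) (Real.exp_nonneg _) (mul_nonneg hc' hp)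

variable {d c35 geo bg Gp b κ S}

/-! ## The frame and the two steps

Same letters, same kernel-form law `ker31` (N06 content, displayed) as `L2Frame`; in addition the (3.46)₄ ∕ (3.46)₆ members of the
family AT U are READ as the L² block inputs `h346` of r06's `B9Ineq346L2SecondDiffUniform.thm34_Gp_l2_second_uniform` (two LEFT
differences) ∕ `B9Ineq346L2RightDiffUniform.thm34_Gp_l2_right_uniform` (two RIGHT differences) — a genuine reading of the leaf's
hypothesis `L2Block (Gp i) B₀ δ₀ U`, members n = 3, 5 — and r06's conclusions (viii′) ∕ (viii″) are WRITTEN back as the members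
n = 3, 5 of the (3.46) block at U′U. -/

variable (c35 geo bg Gp b κ S) in
/-- **THE LETTERS DICTIONARY FOR THE TWO-DIFFERENCE L² MEMBERS (3.46)₄,₆ OF G′** — `L2Frame` plus the readings `read46_4` ∕ `read46_6`
(the members n = 3 ∕ 5 of the family's (3.46) block at U ⇒ r06's L² block inputs `h346` for the letters `∇_k∇_mG′(U)` ∕ `G′(U)∇_k∇_m`,
constant `cL·B₀`, at any rate `δ′ ≦ δ`) and the writings `writeL2_4` ∕ `writeL2_6` (r06's (viii′) at 13δ/20 ∕ (viii″) at 19δ/25 for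
the family's own G′(U′U) ⇒ the members n = 3 ∕ 5 at U′U with (`wL4 B δ`, `wL4δ δ`) ∕ (`wL6 B δ`, `wL6δ δ`)).  A hypothesis structure;
nothing asserted. [cite: Balaban1985BackgroundPropagators, (3.46) p.398 + (3.65) p.402 + p.403; Balaban1984PropagatorsII, (2.52) p.232 + (2.64)–(2.66) p.234 + Lemma 2.1 p.234] -/
structure L2TwoDiffFrame extends L2Frame c35 geo bg Gp b κ S where
  cL : ℝ
  cL_nonneg : 0 ≤ cL
  wL4 : ℝ → ℝ → ℝ
  wL4δ : ℝ → ℝ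
  wL6 : ℝ → ℝ → ℝ
  wL6δ : ℝ → ℝ
  wL4_pos : ∀ B δ : ℝ, 0 ≤ B → 0 < δ → 0 < wL4 B δ
  wL4δ_pos : ∀ δ : ℝ, 0 < δ → 0 < wL4δ δ
  wL6_pos : ∀ B δ : ℝ, 0 ≤ B → 0 < δ → 0 < wL6 B δ
  wL6δ_pos : ∀ δ : ℝ, 0 < δ → 0 < wL6δ δ
  /-- READING (3.46)₄ at U (member n = 3) as the L² block input for the letters ∇_k∇_mG′(U), at any rate δ′ ≦ δ. -/
  read46_4 : ∀ i (α₀ : ℝ) (U : (bg i).Cfg) (B₀ δ δ' : ℝ), MInv ≤ (geo i).M → 0 < α₀ → (geo i).M * α₀ ≤ aInv →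
    (bg i).Reg335 c35 α₀ U → 0 < B₀ → 0 < δ' → δ' ≤ δ → B9FromB6.L2Block (Gp i) B₀ δ U →
    ∀ (k m : κ ⊕ κ) (y y'' : (geo i).Site) (hf ν : S i × ι → ℝ) (Hh : ℝ), 0 ≤ Hh → (∀ x, |hf x| ≤ Hh) →
      (∀ x, blk i x.1 ≠ y → hf x = 0) → (∀ x, blk i x.1 ≠ y'' → ν x = 0) →
      Real.sqrt (∑ x, (hf x * ((conj b (diffLetter (T i) (coord i U) ((((geo i).eta : ℂ))⁻¹) k)) * (conj b (diffLetter (T i) (coord i U) ((((geo i).eta : ℂ))⁻¹) m)) * Gop i U) ν x) ^ 2) ≤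
        cL * B₀ * Hh * Real.exp (-(δ' * (geo i).dist y y'')) * Real.sqrt (∑ x, ν x ^ 2)
  /-- READING (3.46)₆ at U (member n = 5) as the L² block input for the letters G′(U)∇_k∇_m, at any rate δ′ ≦ δ. -/
  read46_6 : ∀ i (α₀ : ℝ) (U : (bg i).Cfg) (B₀ δ δ' : ℝ), MInv ≤ (geo i).M → 0 < α₀ → (geo i).M * α₀ ≤ aInv →
    (bg i).Reg335 c35 α₀ U → 0 < B₀ → 0 < δ' → δ' ≤ δ → B9FromB6.L2Block (Gp i) B₀ δ U →
    ∀ (k m : κ ⊕ κ) (y y'' : (geo i).Site) (hf ν : S i × ι → ℝ) (Hh : ℝ), 0 ≤ Hh → (∀ x, |hf x| ≤ Hh) →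
      (∀ x, blk i x.1 ≠ y → hf x = 0) → (∀ x, blk i x.1 ≠ y'' → ν x = 0) →
      Real.sqrt (∑ x, (hf x * (Gop i U * (conj b (diffLetter (T i) (coord i U) ((((geo i).eta : ℂ))⁻¹) k)) * (conj b (diffLetter (T i) (coord i U) ((((geo i).eta : ℂ))⁻¹) m))) ν x) ^ 2) ≤
        cL * B₀ * Hh * Real.exp (-(δ' * (geo i).dist y y'')) * Real.sqrt (∑ x, ν x ^ 2)
  /-- WRITING (3.46)₄: r06's (viii′) for the family's G′(U′U) at (B, 13δ/20) ⇒ member n = 3 at U′U. -/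
  writeL2_4 : ∀ i (U U' : (bg i).Cfg) (α₁ B δ : ℝ), 0 < α₁ → α₁ ≤ aW → (bg i).Cplx337 α₁ U U' → 0 ≤ B → 0 < δ →
    (∀ (k m : κ ⊕ κ) (y y' : (geo i).Site) (hf μ : S i × ι → ℝ) (Hh : ℝ), 0 ≤ Hh → (∀ x, |hf x| ≤ Hh) →
      (∀ x, blk i x.1 ≠ y → hf x = 0) → (∀ x, blk i x.1 ≠ y' → μ x = 0) →
      Real.sqrt (∑ x, (hf x * ((conj b (diffLetter (T i) (coord i U) ((((geo i).eta : ℂ))⁻¹) k)) * (conj b (diffLetter (T i) (coord i U) ((((geo i).eta : ℂ))⁻¹) m)) * (Gop i ((bg i).mul U' U))) μ x) ^ 2) ≤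
        B * Hh * Real.exp (-(13 / 20 * δ * (geo i).dist y y')) * Real.sqrt (∑ x, μ x ^ 2)) →
    ∀ (lam : (geo i).Loc) (h : (geo i).Cut) (y y' : (geo i).Site), (geo i).cutIn h y → (geo i).suppIn lam y' →
      (Gp i).l2 3 ((bg i).mul U' U) lam h ≤
        wL4 B δ * B9.pref6 ((geo i).len y) 3 * (geo i).cutSup h * Real.exp (-(wL4δ δ * (geo i).dist y y')) * (geo i).l2Norm lam
  /-- WRITING (3.46)₆: r06's (viii″) for the family's G′(U′U) at (B, 19δ/25) ⇒ member n = 5 at U′U. -/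
  writeL2_6 : ∀ i (U U' : (bg i).Cfg) (α₁ B δ : ℝ), 0 < α₁ → α₁ ≤ aW → (bg i).Cplx337 α₁ U U' → 0 ≤ B → 0 < δ →
    (∀ (k m : κ ⊕ κ) (y y' : (geo i).Site) (hf μ : S i × ι → ℝ) (Hh : ℝ), 0 ≤ Hh → (∀ x, |hf x| ≤ Hh) →
      (∀ x, blk i x.1 ≠ y → hf x = 0) → (∀ x, blk i x.1 ≠ y' → μ x = 0) →
      Real.sqrt (∑ x, (hf x * ((Gop i ((bg i).mul U' U)) * (conj b (diffLetter (T i) (coord i U) ((((geo i).eta : ℂ))⁻¹) k)) * (conj b (diffLetter (T i) (coord i U) ((((geo i).eta : ℂ))⁻¹) m))) μ x) ^ 2) ≤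
        B * Hh * Real.exp (-(19 / 25 * δ * (geo i).dist y y')) * Real.sqrt (∑ x, μ x ^ 2)) →
    ∀ (lam : (geo i).Loc) (h : (geo i).Cut) (y y' : (geo i).Site), (geo i).cutIn h y → (geo i).suppIn lam y' →
      (Gp i).l2 5 ((bg i).mul U' U) lam h ≤
        wL6 B δ * B9.pref6 ((geo i).len y) 5 * (geo i).cutSup h * Real.exp (-(wL6δ δ * (geo i).dist y y')) * (geo i).l2Norm lam

omit [CompleteSpace 𝔸] [∀ i, Nonempty (geo i).Site] in
/-- The common r06 input package of the two-difference L² steps at one member: thresholds, the lowered (3.42) majorants, the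
lowered kernel letters of the law `ker31`, and the (3.37) reading — shared bookkeeping of the two theorems below (returned as a
Prop-valued function application to keep the statements short is not possible across r06's binder lists, so each theorem repeats
the application). [folklore] -/
private theorem twoDiff_common (F : L2TwoDiffFrame c35 geo bg Gp b κ S) {B₀ δ₀ : ℝ} (hB₀ : 0 < B₀) (hδ₀ : 0 < δ₀) :
    0 < max (F.cR * B₀) F.BK ∧ 0 < min δ₀ F.δK ∧ 0 ≤ F.cL * B₀ :=
  ⟨lt_max_of_lt_left (mul_pos F.cR_pos hB₀), lt_min hδ₀ F.δK_pos, mul_nonneg F.cL_nonneg hB₀.le⟩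

/-- ★ **THE (3.46)₄-STEP OF SECT. B FOR G′(U′U) (two LEFT differences), INHABITED AT THE LETTERS GIVEN THE KERNEL-FORM LAW**:
every `L2TwoDiffFrame` inhabits `B9SectBStepWhole.StepL2nPos d c35 geo bg Gp GA Cinv Gp 3` — r06's `thm34_Gp_l2_second_uniform` at
the common pair (max(cR·B₀, B_K), min(δ₀, δ_K)) with the (3.46)₄ input read from the family's block at U, `gop_eq` ∘ `mul_law`,
`writeL2_4`.  Honest scope as `stepL2nPos_of_l2Frame` (law `ker31` displayed).
[cite: Balaban1985BackgroundPropagators, Thm 3.4 p.400 + (3.46) p.398 + (3.65) p.402; Balaban1984PropagatorsII, (2.52) p.232 + (2.64)–(2.66) p.234] -/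
theorem stepL2nPos_three_of_l2TwoDiffFrame (F : L2TwoDiffFrame c35 geo bg Gp b κ S)
    (GA : ∀ i, B9.KernelFamily (geo i) (bg i)) (Cinv : ∀ i, B9.SiteKernel (geo i) (bg i)) :
    B9SectBStepWhole.StepL2nPos d c35 geo bg Gp GA Cinv Gp 3 := by
  intro B₀ δ₀ Bβ Bε Bεβ B₁ δ₁ hB₀ hδ₀ _ _
  obtain ⟨hBc, hδm, hL⟩ := twoDiff_common F hB₀ hδ₀
  obtain ⟨a₁, ha₁, B, hB, H⟩ := B9Ineq346L2SecondDiffUniform.thm34_Gp_l2_second_uniform b κ F.dB (min δ₀ F.δK)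
    (max (F.cR * B₀) F.BK) F.Cq F.a₀ F.d₀ F.M₂ (F.Λf (min δ₀ F.δK)) (F.Λvf (min δ₀ F.δK)) F.cv (F.cL * B₀) hBc F.Cq_nonneg
    F.a₀_nonneg F.M₂_nonneg hδm (fun α hα => F.Λf_one_le _ α hδm hα) (fun α hα => F.Λvf_one_le _ α hδm hα) F.cv_nonneg hL F.hrepr
  refine ⟨F.MInv, min a₁ F.aW, F.aInv, (F.wL4 B (min δ₀ F.δK), F.wL4δ (min δ₀ F.δK)), F.MInv_pos, lt_min ha₁ F.aW_pos,
    F.aInv_pos, ⟨F.wL4_pos B _ hB hδm, F.wL4δ_pos _ hδm⟩, ?_⟩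
  intro i hM α₀ hα₀ hMa U hU hT α₁ hα₁ ha U' hU' lam h y y' hcut hs
  obtain ⟨hΔG, hGΔ⟩ := F.reg_inv i α₀ U hM hα₀ hMa hU
  obtain ⟨h1, h2, h3, -⟩ := F.read342 i α₀ U B₀ δ₀ hM hα₀ hMa hU hB₀ hδ₀ hT.1.1.1
  obtain ⟨k1, k2, k3, k4⟩ := F.ker31 i α₀ U hM hα₀ hMa hU
  have h46 := F.read46_4 i α₀ U B₀ δ₀ (min δ₀ F.δK) hM hα₀ hMa hU hB₀ hδm (min_le_left _ _) hT.1.1.2.1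
  obtain ⟨hkF, hsF, h337s, h337F, h337B, hA, hAτ⟩ := F.cplx i α₁ U U' hα₁ hU'
  have hcle : F.cR * B₀ ≤ max (F.cR * B₀) F.BK := le_max_left _ _
  have hKle : F.BK ≤ max (F.cR * B₀) F.BK := le_max_right _ _
  have h1' := hasMajorant_mono (g := toB6 (geo i) (F.Rr i) (F.Hp i)) (fun p : S i × ι => F.blk i p.1) h1
    (K' := fun a a' => max (F.cR * B₀) F.BK * (geo i).len a ^ 2 * Real.exp (-(min δ₀ F.δK * (geo i).dist a a')))
    fun (a a' : (geo i).Site) => prof_le (sq_nonneg ((geo i).len a)) hcle hBc.le (min_le_left δ₀ F.δK) (F.dist_nonneg i a a')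
  have h2' := fun k => hasMajorant_mono (g := toB6 (geo i) (F.Rr i) (F.Hp i)) (fun p : S i × ι => F.blk i p.1) (h2 k)
    (K' := fun a a' => max (F.cR * B₀) F.BK * (geo i).len a * Real.exp (-(min δ₀ F.δK * (geo i).dist a a')))
    fun (a a' : (geo i).Site) => prof_le (F.len_pos i a).le hcle hBc.le (min_le_left δ₀ F.δK) (F.dist_nonneg i a a')
  have h3' := fun k => hasMajorant_mono (g := toB6 (geo i) (F.Rr i) (F.Hp i)) (fun p : S i × ι => F.blk i p.1) (h3 k)
    (K' := fun a a' => max (F.cR * B₀) F.BK * (geo i).len a * Real.exp (-(min δ₀ F.δK * (geo i).dist a a')))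
    fun (a a' : (geo i).Site) => prof_le (F.len_pos i a).le hcle hBc.le (min_le_left δ₀ F.δK) (F.dist_nonneg i a a')
  have k1' := B6RandomWalkKernel.hasKernelBound_mono (g := toB6 (geo i) (F.Rr i) (F.Hp i)) (fun p : S i × ι => F.blk i p.1)
    (F.v_pos i) k1
    (K' := fun a a' => max (F.cR * B₀) F.BK * (geo i).len a ^ 2 * Real.exp (-(min δ₀ F.δK * (geo i).dist a a')))
    fun (a a' : (geo i).Site) => prof_le (sq_nonneg ((geo i).len a)) hKle hBc.le (min_le_right δ₀ F.δK) (F.dist_nonneg i a a')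
  have k2' := fun k => B6RandomWalkKernel.hasKernelBound_mono (g := toB6 (geo i) (F.Rr i) (F.Hp i))
    (fun p : S i × ι => F.blk i p.1) (F.v_pos i) (k2 k)
    (K' := fun a a' => max (F.cR * B₀) F.BK * (geo i).len a * Real.exp (-(min δ₀ F.δK * (geo i).dist a a')))
    fun (a a' : (geo i).Site) => prof_le (F.len_pos i a).le hKle hBc.le (min_le_right δ₀ F.δK) (F.dist_nonneg i a a')
  have k3' := fun l => B6RandomWalkKernel.hasKernelBound_mono (g := toB6 (geo i) (F.Rr i) (F.Hp i))
    (fun p : S i × ι => F.blk i p.1) (F.v_pos i) (k3 l)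
    (K' := fun a a' => max (F.cR * B₀) F.BK * (geo i).len a * Real.exp (-(min δ₀ F.δK * (geo i).dist a a')))
    fun (a a' : (geo i).Site) => prof_le (F.len_pos i a).le hKle hBc.le (min_le_right δ₀ F.δK) (F.dist_nonneg i a a')
  have k4' := fun k l => B6RandomWalkKernel.hasKernelBound_mono (g := toB6 (geo i) (F.Rr i) (F.Hp i))
    (fun p : S i × ι => F.blk i p.1) (F.v_pos i) (k4 k l)
    (K' := fun a a' => max (F.cR * B₀) F.BK * Real.exp (-(min δ₀ F.δK * (geo i).dist a a')))
    fun (a a' : (geo i).Site) => by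
      have h := prof_le (p := 1) zero_le_one hKle hBc.le (min_le_right δ₀ F.δK) (F.dist_nonneg i a a')
      simpa only [mul_one] using h
  obtain ⟨hinv1, hinv2, hout⟩ := H (F.T i) (F.coord i U) (F.blk i) (F.kQ i U) (F.sQ i U) (F.cfun i) (F.w i U)
    (F.dist_nonneg i) (F.triangle i) (F.dist_self i) (F.dist_comm i) (F.len_pos i) (F.eta_le_len i) (F.eta_pos i)
    (fun α hα hα1 => F.h261 i _ α hδm hα hα1) (fun α hα => F.hST i _ α hδm hα) (F.unitary i U)
    (F.stencilB i) (F.stencilF i) (F.stencil0 i) (F.w_nonneg i U) (F.card_w i U) (F.hkQ i U) (F.hsQ i U) (F.hcfun i)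
    hΔG hGΔ h1' h2' h3' (F.v_pos i) F.cKv_pos k1' k2' k3' k4' (F.hvol i) (fun α hα => F.hSTv i _ α hδm hα) h46
    α₁ hα₁.le (le_trans ha (min_le_left _ _)) (F.expA i U U') (F.kF i U U') (F.sF i U U')
    hkF hsF h337s h337F h337B hA hAτ
  have hG := F.gop_eq i ((bg i).mul U' U) _ _ (F.mul_law i α₁ U U' hα₁ hU') hinv1 hinv2
  rw [← hG] at hout
  exact F.writeL2_4 i U U' α₁ B (min δ₀ F.δK) hα₁ (le_trans ha (min_le_right _ _)) hU' hB hδm hout lam h y y' hcut hs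

/-- ★ **THE (3.46)₆-STEP OF SECT. B FOR G′(U′U) (two RIGHT differences), INHABITED AT THE LETTERS GIVEN THE KERNEL-FORM LAW**:
every `L2TwoDiffFrame` inhabits `B9SectBStepWhole.StepL2nPos d c35 geo bg Gp GA Cinv Gp 5` — r06's `thm34_Gp_l2_right_uniform`, same
bookkeeping as the (3.46)₄-step, `writeL2_6`. [cite: Balaban1985BackgroundPropagators, Thm 3.4 p.400 + (3.46) p.398 + (3.65) p.402 + p.403 l.7–9; Balaban1984PropagatorsII, (2.52) p.232 + (2.64)–(2.66) p.234] -/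
theorem stepL2nPos_five_of_l2TwoDiffFrame (F : L2TwoDiffFrame c35 geo bg Gp b κ S)
    (GA : ∀ i, B9.KernelFamily (geo i) (bg i)) (Cinv : ∀ i, B9.SiteKernel (geo i) (bg i)) :
    B9SectBStepWhole.StepL2nPos d c35 geo bg Gp GA Cinv Gp 5 := by
  intro B₀ δ₀ Bβ Bε Bεβ B₁ δ₁ hB₀ hδ₀ _ _
  obtain ⟨hBc, hδm, hL⟩ := twoDiff_common F hB₀ hδ₀
  obtain ⟨a₁, ha₁, B, hB, H⟩ := B9Ineq346L2RightDiffUniform.thm34_Gp_l2_right_uniform b κ F.dB (min δ₀ F.δK)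
    (max (F.cR * B₀) F.BK) F.Cq F.a₀ F.d₀ F.M₂ (F.Λf (min δ₀ F.δK)) (F.Λvf (min δ₀ F.δK)) F.cv (F.cL * B₀) hBc F.Cq_nonneg
    F.a₀_nonneg F.M₂_nonneg hδm (fun α hα => F.Λf_one_le _ α hδm hα) (fun α hα => F.Λvf_one_le _ α hδm hα) F.cv_nonneg hL F.hrepr
  refine ⟨F.MInv, min a₁ F.aW, F.aInv, (F.wL6 B (min δ₀ F.δK), F.wL6δ (min δ₀ F.δK)), F.MInv_pos, lt_min ha₁ F.aW_pos,
    F.aInv_pos, ⟨F.wL6_pos B _ hB hδm, F.wL6δ_pos _ hδm⟩, ?_⟩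
  intro i hM α₀ hα₀ hMa U hU hT α₁ hα₁ ha U' hU' lam h y y' hcut hs
  obtain ⟨hΔG, hGΔ⟩ := F.reg_inv i α₀ U hM hα₀ hMa hU
  obtain ⟨h1, h2, h3, -⟩ := F.read342 i α₀ U B₀ δ₀ hM hα₀ hMa hU hB₀ hδ₀ hT.1.1.1
  obtain ⟨k1, k2, k3, k4⟩ := F.ker31 i α₀ U hM hα₀ hMa hU
  have h46 := F.read46_6 i α₀ U B₀ δ₀ (min δ₀ F.δK) hM hα₀ hMa hU hB₀ hδm (min_le_left _ _) hT.1.1.2.1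
  obtain ⟨hkF, hsF, h337s, h337F, h337B, hA, hAτ⟩ := F.cplx i α₁ U U' hα₁ hU'
  have hcle : F.cR * B₀ ≤ max (F.cR * B₀) F.BK := le_max_left _ _
  have hKle : F.BK ≤ max (F.cR * B₀) F.BK := le_max_right _ _
  have h1' := hasMajorant_mono (g := toB6 (geo i) (F.Rr i) (F.Hp i)) (fun p : S i × ι => F.blk i p.1) h1
    (K' := fun a a' => max (F.cR * B₀) F.BK * (geo i).len a ^ 2 * Real.exp (-(min δ₀ F.δK * (geo i).dist a a')))
    fun (a a' : (geo i).Site) => prof_le (sq_nonneg ((geo i).len a)) hcle hBc.le (min_le_left δ₀ F.δK) (F.dist_nonneg i a a')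
  have h2' := fun k => hasMajorant_mono (g := toB6 (geo i) (F.Rr i) (F.Hp i)) (fun p : S i × ι => F.blk i p.1) (h2 k)
    (K' := fun a a' => max (F.cR * B₀) F.BK * (geo i).len a * Real.exp (-(min δ₀ F.δK * (geo i).dist a a')))
    fun (a a' : (geo i).Site) => prof_le (F.len_pos i a).le hcle hBc.le (min_le_left δ₀ F.δK) (F.dist_nonneg i a a')
  have h3' := fun k => hasMajorant_mono (g := toB6 (geo i) (F.Rr i) (F.Hp i)) (fun p : S i × ι => F.blk i p.1) (h3 k)
    (K' := fun a a' => max (F.cR * B₀) F.BK * (geo i).len a * Real.exp (-(min δ₀ F.δK * (geo i).dist a a')))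
    fun (a a' : (geo i).Site) => prof_le (F.len_pos i a).le hcle hBc.le (min_le_left δ₀ F.δK) (F.dist_nonneg i a a')
  have k1' := B6RandomWalkKernel.hasKernelBound_mono (g := toB6 (geo i) (F.Rr i) (F.Hp i)) (fun p : S i × ι => F.blk i p.1)
    (F.v_pos i) k1
    (K' := fun a a' => max (F.cR * B₀) F.BK * (geo i).len a ^ 2 * Real.exp (-(min δ₀ F.δK * (geo i).dist a a')))
    fun (a a' : (geo i).Site) => prof_le (sq_nonneg ((geo i).len a)) hKle hBc.le (min_le_right δ₀ F.δK) (F.dist_nonneg i a a')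
  have k2' := fun k => B6RandomWalkKernel.hasKernelBound_mono (g := toB6 (geo i) (F.Rr i) (F.Hp i))
    (fun p : S i × ι => F.blk i p.1) (F.v_pos i) (k2 k)
    (K' := fun a a' => max (F.cR * B₀) F.BK * (geo i).len a * Real.exp (-(min δ₀ F.δK * (geo i).dist a a')))
    fun (a a' : (geo i).Site) => prof_le (F.len_pos i a).le hKle hBc.le (min_le_right δ₀ F.δK) (F.dist_nonneg i a a')
  have k3' := fun l => B6RandomWalkKernel.hasKernelBound_mono (g := toB6 (geo i) (F.Rr i) (F.Hp i))
    (fun p : S i × ι => F.blk i p.1) (F.v_pos i) (k3 l)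
    (K' := fun a a' => max (F.cR * B₀) F.BK * (geo i).len a * Real.exp (-(min δ₀ F.δK * (geo i).dist a a')))
    fun (a a' : (geo i).Site) => prof_le (F.len_pos i a).le hKle hBc.le (min_le_right δ₀ F.δK) (F.dist_nonneg i a a')
  have k4' := fun k l => B6RandomWalkKernel.hasKernelBound_mono (g := toB6 (geo i) (F.Rr i) (F.Hp i))
    (fun p : S i × ι => F.blk i p.1) (F.v_pos i) (k4 k l)
    (K' := fun a a' => max (F.cR * B₀) F.BK * Real.exp (-(min δ₀ F.δK * (geo i).dist a a')))
    fun (a a' : (geo i).Site) => by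
      have h := prof_le (p := 1) zero_le_one hKle hBc.le (min_le_right δ₀ F.δK) (F.dist_nonneg i a a')
      simpa only [mul_one] using h
  obtain ⟨hinv1, hinv2, hout⟩ := H (F.T i) (F.coord i U) (F.blk i) (F.kQ i U) (F.sQ i U) (F.cfun i) (F.w i U)
    (F.dist_nonneg i) (F.triangle i) (F.dist_self i) (F.dist_comm i) (F.len_pos i) (F.eta_le_len i) (F.eta_pos i)
    (fun α hα hα1 => F.h261 i _ α hδm hα hα1) (fun α hα => F.hST i _ α hδm hα) (F.unitary i U)
    (F.stencilB i) (F.stencilF i) (F.stencil0 i) (F.w_nonneg i U) (F.card_w i U) (F.hkQ i U) (F.hsQ i U) (F.hcfun i)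
    hΔG hGΔ h1' h2' h3' (F.v_pos i) F.cKv_pos k1' k2' k3' k4' (F.hvol i) (fun α hα => F.hSTv i _ α hδm hα) h46
    α₁ hα₁.le (le_trans ha (min_le_left _ _)) (F.expA i U U') (F.kF i U U') (F.sF i U U')
    hkF hsF h337s h337F h337B hA hAτ
  have hG := F.gop_eq i ((bg i).mul U' U) _ _ (F.mul_law i α₁ U U' hα₁ hU') hinv1 hinv2
  rw [← hG] at hout
  exact F.writeL2_6 i U U' α₁ B (min δ₀ F.δK) hα₁ (le_trans ha (min_le_right _ _)) hU' hB hδm hout lam h y y' hcut hs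

end Literature.MathematicalPhysics.QuantumFieldTheory.Balaban1983to89.B9SectBGpStepAtLettersL2TwoDiff
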